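import Literature.ComputerArithmetic.Rump2026SparseI.SparseCholesky
import Literature.Analysis.ValidatedNumerics.ParametricEigenMargin
import HarnessLib

/-!
# The sparse-Cholesky `λ_min` floor in the fields of a certificate (Rump 2026 I, Lemma 2.10, `γ`-model)

HONEST FRAMING (cell `certnum`, CERTIFIED-NUMERICS STACK, D-0105 (6); layer L4 = Lean soundness
statements per certificate kind). This file types NO new mathematics: it re-packages the tree's
`Literature.ComputerArithmetic.Rump2026SparseI.SparseCholeskyRun.sub_mul_lt_quadForm_of_shifted`
(Rump 2026 I Lemma 2.10 in the `γ`-model, typed from the page `paper:url-16a6c3477380` p0012 L41–47 /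
p0013 L2–37) so that its hypotheses are LITERALLY the quantities a verified sparse s.p.d. kernel holds
after factoring the shifted matrix — the shape of the `ila-spd-shift-chol/1` certificate of
`cap.ila.spd` (certnum-ila-1, `alpha_rump2026`, CERTIFIED since 0.2.0.dev6):

* `P i` — the STORED row indices of column `i` of the computed factor `R̃ = L̃ᵀ` (diagonal included;
  numerically zero stored entries, as inside supernodes, are allowed), with the modelling hypothesis
  that stage `(i, j)` forms products only between stored entries: `S i j ⊆ P i ∩ P j`;
* `μ i ≥ |P i|` — the kernel's row counts of `L̃` (`np.diff(L.tocsr().indptr)`); an over-count is sound;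
* `(μ i + 1) u < 1` (the kernel checks `(μ_max + 1) u < 1/2`);
* `d j ≥ 0` with `(1 + γ_{μ_j+1}) ã_{jj} ≤ d_j²` — the kernel's upward-rounded `Dr`;
* a Collatz pair `(v, c)`, `v > 0`, `(M v)_i ≤ c v_i` for `M_{ij} = γ_{min(μ_i,μ_j)+1} d_i d_j`
  (`errMatrix`), every operation rounded upward on nonnegative floats;
* the shift: `Ã` agrees with (the permuted) `A` off the diagonal and `ã_{jj} ≤ a_{jj} − s`
  (`Ã = fl∇(P(A − sI)Pᵀ)`).

Conclusion: `(s − c)·xᵀx < xᵀAx` for `x ≠ 0` over any linearly ordered field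
(`SparseCholeskyRun.sub_mul_lt_quadForm_of_rowCounts`); over `ℝ`, `s − c ≤ λ_i(A)` for every `i`
(`sub_le_eigenvalues_of_rowCounts`, CITING `Literature.Analysis.ValidatedNumerics.ParametricEigenMargin.
le_eigenvalues_of_forall_form_real`), also through a fill-reducing permutation `σ`
(`sub_le_eigenvalues_of_rowCounts_perm`).  The two reductions to the tree theorem are elementary and
were so far only comments in `spd.py`: (a) `|S i j| + 2 ≤ min(μ_i, μ_j) + 1` from the stored pattern
(`card_add_two_le_of_subset_pattern`, generalising `card_add_two_le_min_colCount`, which assumed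
«only NONZERO products»); (b) `(1 − u)^{−(|S_jj|+2)} ≤ (1 − u)^{−(μ_j+1)} ≤ 1 + γ_{μ_j+1}`
(`inv_one_sub_pow_le_one_add_gamma_of_le`, from `Higham2002.inv_one_sub_pow_sub_one_le_gamma`).

WHAT IS NOT CERTIFIED BY THESE STATEMENTS: the modelling hypothesis itself — that the library's
floating-point Cholesky (CHOLMOD via cvxopt in `cap.ila.spd`) IS a `SparseCholeskyRun` over the stored
pattern (textbook recurrence, one rounding per operation in some order, no underflow; `spd.py` H-CHOL /
H-IEEE) — stays the hypothesis `hrun` + `hSP`; a reader re-derives its own Collatz pair unless the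
certificate carries `(v, c)`; `lam_lo` is a LOWER BOUND for `λ_min(A)`, never an enclosure.
-/

namespace Literature.ComputerArithmetic.Rump2026SparseI

open Finset Matrix
open Literature.ComputerArithmetic.Higham2002
open Literature.ComputerArithmetic.Rump2006

variable {K : Type*} [Field K] [LinearOrder K] [IsStrictOrderedRing K]

section Certificate

variable {u : K} {n : ℕ}

/-- **Admissibility of `Φ_{ij} = min(μ_i, μ_j) + 1` from the STORED pattern.** If stage `(i, j)`,
`i ≤ j`, forms products only over earlier rows `k < i` that are stored in BOTH columns `i` and `j`
(`S ⊆ P i ∩ P j`), and the diagonal positions are stored (`i ∈ P i`, `j ∈ P j`), then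
`|S| + 2 ≤ min(|P i|, |P j|) + 1`.  Numerically zero stored entries are allowed (supernodal factors);
`card_add_two_le_min_colCount` is the special case `P i = {k | r̃_{ki} ≠ 0}`.
[cite: Rump2026SparseI, Lemma 2.10 (proof: «the number of nonzero products … does not exceed min(μ_i, μ_j)»)] -/
theorem card_add_two_le_of_subset_pattern {P : Fin n → Finset (Fin n)} {S : Finset (Fin n)}
    {i j : Fin n} (hij : i ≤ j) (hSlt : ∀ k ∈ S, k < i) (hSP : S ⊆ P i ∩ P j)
    (hii : i ∈ P i) (hjj : j ∈ P j) : S.card + 2 ≤ min (P i).card (P j).card + 1 := by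
  have hiS : i ∉ S := fun h => lt_irrefl _ (hSlt i h)
  have hjS : j ∉ S := fun h => absurd ((hSlt j h).trans_le hij) (lt_irrefl _)
  have hi : S.card + 1 ≤ (P i).card := by
    have := card_le_card (insert_subset hii (hSP.trans inter_subset_left))
    rwa [card_insert_of_notMem hiS] at this
  have hj : S.card + 1 ≤ (P j).card := by
    have := card_le_card (insert_subset hjj (hSP.trans inter_subset_right))
    rwa [card_insert_of_notMem hjS] at this
  omega

/-- `(1 − u)^{−m} ≤ 1 + γ_{m'}` for `m ≤ m'`, `0 ≤ u < 1`, `m' u < 1` (Bernoulli and monotonicity) — why a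
majorant built with `1 + γ_{μ_j+1}` dominates the theorem's `(1 − u)^{−(|S_jj|+2)}`.
[cite: Higham2002ASNA, Lemma 3.1] -/
theorem inv_one_sub_pow_le_one_add_gamma_of_le (hu : 0 ≤ u) (hu1 : u < 1) {m m' : ℕ} (hmm : m ≤ m')
    (hm' : (m' : K) * u < 1) : ((1 - u) ^ m)⁻¹ ≤ 1 + gamma u m' := by
  have h1u : 0 < 1 - u := by linarith
  have hmono : (1 - u) ^ m' ≤ (1 - u) ^ m := pow_le_pow_of_le_one h1u.le (by linarith) hmm
  have hinv : ((1 - u) ^ m)⁻¹ ≤ ((1 - u) ^ m')⁻¹ := inv_anti₀ (pow_pos h1u m') hmono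
  linarith [inv_one_sub_pow_sub_one_le_gamma hu1 hm']

namespace SparseCholeskyRun

/-- **F1-13 in the fields of a certificate** (Rump 2026 I Lemma 2.10 in the `γ`-model, Collatz form,
with the shift): the sparse floating-point Cholesky of the symmetric shifted matrix `Ã` runs to
completion with positive pivots, forming at stage `(i, j)` only products between STORED positions
(`S i j ⊆ P i ∩ P j`, diagonal stored); `μ_i ≥ |P i|` with `(μ_i + 1) u < 1`; `d_j ≥ 0` with
`(1 + γ_{μ_j+1}) ã_{jj} ≤ d_j²`; `v > 0` and `(M v)_i ≤ c v_i` for `M_{ij} = γ_{min(μ_i,μ_j)+1} d_i d_j`;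
`Ã` agrees with `A` off the diagonal and `ã_{jj} ≤ a_{jj} − s`.  Then `(s − c)·xᵀx < xᵀAx` for every
`x ≠ 0` — i.e. `λ_min(A) > s − c`.  Corollary of `sub_mul_lt_quadForm_of_shifted` with
`Φ_{ij} := min(μ_i, μ_j) + 1`.
[cite: Rump2026SparseI, Lemma 2.10 (2.15) with Thm 1.1 (1.4)] [cite: Rump2006, Corollary 2.4] -/
theorem sub_mul_lt_quadForm_of_rowCounts (hu : 0 ≤ u) (hu1 : u < 1)
    {A At R : Matrix (Fin n) (Fin n) K} {S : Fin n → Fin n → Finset (Fin n)} (hAt : Atᵀ = At)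
    (hrun : SparseCholeskyRun u At R S) (hpos : ∀ j, 0 < R j j)
    {P : Fin n → Finset (Fin n)} (hSP : ∀ i j : Fin n, i ≤ j → S i j ⊆ P i ∩ P j)
    (hPdiag : ∀ i, i ∈ P i) {μ : Fin n → ℕ} (hμ : ∀ i, (P i).card ≤ μ i)
    (hμu : ∀ i, ((μ i + 1 : ℕ) : K) * u < 1)
    {d : Fin n → K} (hd0 : ∀ j, 0 ≤ d j) (hd : ∀ j, (1 + gamma u (μ j + 1)) * At j j ≤ d j ^ 2)
    {v : Fin n → K} (hv : ∀ i, 0 < v i) {c : K}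
    (hc : ∀ i, (errMatrix u (fun i j => min (μ i) (μ j) + 1) d *ᵥ v) i ≤ c * v i)
    {s : K} (hoff : ∀ i j, i ≠ j → At i j = A i j) (hdiag : ∀ i, At i i ≤ A i i - s)
    (x : Fin n → K) (hx : x ≠ 0) : (s - c) * (x ⬝ᵥ x) < x ⬝ᵥ (A *ᵥ x) := by
  -- admissibility of `Φ = min(μ_i, μ_j) + 1` on the stored pattern
  have hadm : ∀ i j : Fin n, i ≤ j → (S i j).card + 2 ≤ min (μ i) (μ j) + 1 := by
    intro i j hij
    have h1 := card_add_two_le_of_subset_pattern hij (hrun.subset i j hij) (hSP i j hij)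
      (hPdiag i) (hPdiag j)
    have h2 : min (P i).card (P j).card ≤ min (μ i) (μ j) := min_le_min (hμ i) (hμ j)
    omega
  have hΦ : ∀ i j : Fin n, i ≤ j →
      (S i j).card + 2 ≤ min (μ i) (μ j) + 1 ∧ (S i j).card + 2 ≤ min (μ j) (μ i) + 1 := by
    intro i j hij
    have h := hadm i j hij
    exact ⟨h, by rwa [min_comm] at h⟩
  have hΦs : ∀ i j : Fin n, min (μ i) (μ j) + 1 = min (μ j) (μ i) + 1 := fun i j => by rw [min_comm]
  have hΦu : ∀ i j : Fin n, (((min (μ i) (μ j) + 1 : ℕ)) : K) * u < 1 := by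
    intro i j
    have hle : (((min (μ i) (μ j) + 1 : ℕ)) : K) ≤ ((μ i + 1 : ℕ) : K) := by
      exact_mod_cast Nat.succ_le_succ (min_le_left _ _)
    exact lt_of_le_of_lt (mul_le_mul_of_nonneg_right hle hu) (hμu i)
  -- the majorant: `(1 − u)^{−(|S_jj|+2)} ã_jj ≤ (1 + γ_{μ_j+1}) ã_jj ≤ d_j²`, using `ã_jj ≥ 0` from the run
  have hd' : ∀ j, ((1 - u) ^ ((S j j).card + 2))⁻¹ * At j j ≤ d j ^ 2 := by
    intro j
    have hA0 : 0 ≤ At j j := (hrun.sum_mul_self_le_inv_pow hu hu1 j).2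
    have hle : (S j j).card + 2 ≤ μ j + 1 := by
      have := hadm j j le_rfl
      rwa [min_self] at this
    have hμu' : ((μ j + 1 : ℕ) : K) * u < 1 := hμu j
    have hγ := inv_one_sub_pow_le_one_add_gamma_of_le hu hu1 hle (by exact_mod_cast hμu')
    exact le_trans (mul_le_mul_of_nonneg_right hγ hA0) (hd j)
  exact sub_mul_lt_quadForm_of_shifted hu hu1 hAt hrun hpos (Φ := fun i j => min (μ i) (μ j) + 1)
    hΦ hΦs hΦu hd0 hd' hv hc hoff hdiag x hx

end SparseCholeskyRun

omit [IsStrictOrderedRing K] in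
/-- A quadratic-form floor transfers through a simultaneous row/column PERMUTATION (fill-reducing
ordering): if `t·xᵀx < xᵀ(PAPᵀ)x` for all `x ≠ 0`, where `(PAPᵀ)_{ij} = a_{σ i, σ j}`, then
`t·yᵀy < yᵀAy` for all `y ≠ 0` (plumbing for `sub_le_eigenvalues_of_rowCounts_perm`). [folklore] -/
private theorem mul_dotProduct_lt_quadForm_of_submatrix {A : Matrix (Fin n) (Fin n) K}
    (σ : Fin n ≃ Fin n) {t : K}
    (h : ∀ x : Fin n → K, x ≠ 0 → t * (x ⬝ᵥ x) < x ⬝ᵥ (A.submatrix σ σ *ᵥ x))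
    (y : Fin n → K) (hy : y ≠ 0) : t * (y ⬝ᵥ y) < y ⬝ᵥ (A *ᵥ y) := by
  have hx : y ∘ σ ≠ 0 := by
    intro h0
    apply hy
    funext i
    have := congrFun h0 (σ.symm i)
    simpa using this
  have h1 := h (y ∘ σ) hx
  rw [submatrix_mulVec_equiv, comp_equiv_dotProduct_comp_equiv] at h1
  have e : (y ∘ σ) ∘ σ.symm = y := by
    funext i; simp
  rwa [e, comp_equiv_dotProduct_comp_equiv] at h1

end Certificate

/-! ### Over `ℝ`: the reported number `lam_lo = s − c` bounds every eigenvalue -/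

section Real

variable {n : ℕ}

/-- **The certificate's number is an eigenvalue floor**: for symmetric `A`, under the hypotheses of
`SparseCholeskyRun.sub_mul_lt_quadForm_of_rowCounts` over `ℝ`, `s − c ≤ λ_i(A)` for every `i` (so any
`lam_lo ≤ s − c`, e.g. `s − c` rounded downward, is a certified lower bound of `λ_min(A)`).  Rayleigh
step CITED from `Literature.Analysis.ValidatedNumerics.ParametricEigenMargin.le_eigenvalues_of_forall_form_real`.
[cite: Rump2026SparseI, Lemma 2.10 (2.15) with Thm 1.1 (1.4)] [cite: Rump2006, Corollary 2.4] -/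
theorem sub_le_eigenvalues_of_rowCounts {u : ℝ} (hu : 0 ≤ u) (hu1 : u < 1)
    {A At R : Matrix (Fin n) (Fin n) ℝ} (hA : A.IsHermitian) {S : Fin n → Fin n → Finset (Fin n)}
    (hAt : Atᵀ = At)
    (hrun : SparseCholeskyRun u At R S) (hpos : ∀ j, 0 < R j j)
    {P : Fin n → Finset (Fin n)} (hSP : ∀ i j : Fin n, i ≤ j → S i j ⊆ P i ∩ P j)
    (hPdiag : ∀ i, i ∈ P i) {μ : Fin n → ℕ} (hμ : ∀ i, (P i).card ≤ μ i)
    (hμu : ∀ i, ((μ i + 1 : ℕ) : ℝ) * u < 1)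
    {d : Fin n → ℝ} (hd0 : ∀ j, 0 ≤ d j) (hd : ∀ j, (1 + gamma u (μ j + 1)) * At j j ≤ d j ^ 2)
    {v : Fin n → ℝ} (hv : ∀ i, 0 < v i) {c : ℝ}
    (hc : ∀ i, (errMatrix u (fun i j => min (μ i) (μ j) + 1) d *ᵥ v) i ≤ c * v i)
    {s : ℝ} (hoff : ∀ i j, i ≠ j → At i j = A i j) (hdiag : ∀ i, At i i ≤ A i i - s) (i : Fin n) :
    s - c ≤ hA.eigenvalues i := by
  refine Literature.Analysis.ValidatedNumerics.ParametricEigenMargin.le_eigenvalues_of_forall_form_real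
    hA (fun x => ?_) i
  by_cases hx : x = 0
  · rw [hx]; simp
  · exact (hrun.sub_mul_lt_quadForm_of_rowCounts hu hu1 hAt hpos hSP hPdiag hμ hμu hd0 hd hv hc
      hoff hdiag x hx).le

/-- **Through a fill-reducing permutation**: the kernel factors `Ã = fl∇(P(A − sI)Pᵀ)`, i.e. `Ã`
agrees with `a_{σ i, σ j}` off the diagonal and `ã_{ii} ≤ a_{σ i, σ i} − s`; the same certificate fields
then give `s − c ≤ λ_i(A)` for every `i` of the ORIGINAL symmetric `A`.
[cite: Rump2026SparseI, Lemma 2.10 (2.15) with Thm 1.1 (1.4)] [cite: Rump2006, Corollary 2.4] -/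
theorem sub_le_eigenvalues_of_rowCounts_perm {u : ℝ} (hu : 0 ≤ u) (hu1 : u < 1)
    {A At R : Matrix (Fin n) (Fin n) ℝ} (hA : A.IsHermitian) (σ : Fin n ≃ Fin n)
    {S : Fin n → Fin n → Finset (Fin n)} (hAt : Atᵀ = At)
    (hrun : SparseCholeskyRun u At R S) (hpos : ∀ j, 0 < R j j)
    {P : Fin n → Finset (Fin n)} (hSP : ∀ i j : Fin n, i ≤ j → S i j ⊆ P i ∩ P j)
    (hPdiag : ∀ i, i ∈ P i) {μ : Fin n → ℕ} (hμ : ∀ i, (P i).card ≤ μ i)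
    (hμu : ∀ i, ((μ i + 1 : ℕ) : ℝ) * u < 1)
    {d : Fin n → ℝ} (hd0 : ∀ j, 0 ≤ d j) (hd : ∀ j, (1 + gamma u (μ j + 1)) * At j j ≤ d j ^ 2)
    {v : Fin n → ℝ} (hv : ∀ i, 0 < v i) {c : ℝ}
    (hc : ∀ i, (errMatrix u (fun i j => min (μ i) (μ j) + 1) d *ᵥ v) i ≤ c * v i)
    {s : ℝ} (hoff : ∀ i j, i ≠ j → At i j = A (σ i) (σ j)) (hdiag : ∀ i, At i i ≤ A (σ i) (σ i) - s)
    (i : Fin n) : s - c ≤ hA.eigenvalues i := by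
  have hoff' : ∀ i j, i ≠ j → At i j = A.submatrix σ σ i j := fun i j hij => by
    rw [Matrix.submatrix_apply]; exact hoff i j hij
  have hdiag' : ∀ i, At i i ≤ A.submatrix σ σ i i - s := fun i => by
    rw [Matrix.submatrix_apply]; exact hdiag i
  have hfloor := mul_dotProduct_lt_quadForm_of_submatrix σ
    (fun x hx => hrun.sub_mul_lt_quadForm_of_rowCounts hu hu1 hAt hpos hSP hPdiag hμ hμu hd0 hd hv
      hc hoff' hdiag' x hx)
  refine Literature.Analysis.ValidatedNumerics.ParametricEigenMargin.le_eigenvalues_of_forall_form_real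
    hA (fun y => ?_) i
  by_cases hy : y = 0
  · rw [hy]; simp
  · exact (hfloor y hy).le

end Real

/-! ### Append 2026-08-27 (certnum-lean-1 g4): the MEMBERS floor `lam_lo_members`

The `rad=` path of `cap.ila.spd.lam_min_lower_sparse`: with a symmetric entrywise-nonnegative radius
`Rad` and a Collatz pair `(w, r)` for it, the floor degrades by `r ≥ ‖Rad‖₂` and then holds for EVERY
member `X` of `[A − Rad, A + Rad]` — in particular for the EXACT Gram matrix `FᵀF` (resp. `FFᵀ`)
enclosed by its rounded product, which is how `cap.ila.gen` obtains the Gram-floor hypotheses of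
`Literature.Analysis.Matrix.SparseLUSplit.lu_split_solution_bound`.  Composition of the floor above
with the tree's `Rump2006.quadForm_sub_abs_le` + `quadForm_le_of_mulVec_le` (Rump 2006 Cor 2.7). -/

section Members

variable {u : K} {n : ℕ}

namespace SparseCholeskyRun

/-- **The MEMBERS floor (`lam_lo_members`)**: under the hypotheses of `sub_mul_lt_quadForm_of_rowCounts`
for the (floating-point) matrix `A`, and a symmetric entrywise-nonnegative radius `Rad` with a Collatz
pair `w > 0`, `(Rad w)_i ≤ r w_i` (so `‖Rad‖₂ ≤ r`), EVERY `X` with `|X − A| ≤ Rad` (not necessarily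
symmetric) satisfies `(s − c − r)·yᵀy < yᵀXy` for `y ≠ 0` — the floor the kernel reports for all members
of `[A − Rad, A + Rad]`, e.g. for the EXACT Gram matrix `FᵀF` enclosed by its rounded product.
[cite: Rump2026SparseI, Lemma 2.10 (2.15) with Thm 1.1 (1.4)] [cite: Rump2006, Corollary 2.7 and (2.11)–(2.12)] -/
theorem sub_sub_mul_lt_quadForm_of_rowCounts_members (hu : 0 ≤ u) (hu1 : u < 1)
    {A At R : Matrix (Fin n) (Fin n) K} {S : Fin n → Fin n → Finset (Fin n)} (hAt : Atᵀ = At)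
    (hrun : SparseCholeskyRun u At R S) (hpos : ∀ j, 0 < R j j)
    {P : Fin n → Finset (Fin n)} (hSP : ∀ i j : Fin n, i ≤ j → S i j ⊆ P i ∩ P j)
    (hPdiag : ∀ i, i ∈ P i) {μ : Fin n → ℕ} (hμ : ∀ i, (P i).card ≤ μ i)
    (hμu : ∀ i, ((μ i + 1 : ℕ) : K) * u < 1)
    {d : Fin n → K} (hd0 : ∀ j, 0 ≤ d j) (hd : ∀ j, (1 + gamma u (μ j + 1)) * At j j ≤ d j ^ 2)
    {v : Fin n → K} (hv : ∀ i, 0 < v i) {c : K}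
    (hc : ∀ i, (errMatrix u (fun i j => min (μ i) (μ j) + 1) d *ᵥ v) i ≤ c * v i)
    {s : K} (hoff : ∀ i j, i ≠ j → At i j = A i j) (hdiag : ∀ i, At i i ≤ A i i - s)
    {Rad : Matrix (Fin n) (Fin n) K} (hRad : Radᵀ = Rad) (hRad0 : ∀ i j, 0 ≤ Rad i j)
    {w : Fin n → K} (hw : ∀ i, 0 < w i) {r : K} (hr : ∀ i, (Rad *ᵥ w) i ≤ r * w i)
    (X : Matrix (Fin n) (Fin n) K) (hX : ∀ i j, |X i j - A i j| ≤ Rad i j)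
    (y : Fin n → K) (hy : y ≠ 0) : (s - c - r) * (y ⬝ᵥ y) < y ⬝ᵥ (X *ᵥ y) := by
  have h1 := hrun.sub_mul_lt_quadForm_of_rowCounts hu hu1 hAt hpos hSP hPdiag hμ hμu hd0 hd hv hc
    hoff hdiag y hy
  have h3 := quadForm_sub_abs_le hX y
  have h4 := quadForm_le_of_mulVec_le hRad hRad0 hw hr (fun i => |y i|)
  have hyy : (fun i => |y i|) ⬝ᵥ (fun i => |y i|) = y ⬝ᵥ y := by
    simp only [dotProduct]; exact sum_congr rfl fun i _ => abs_mul_abs_self _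
  rw [hyy] at h4
  have hxx : 0 ≤ y ⬝ᵥ y := sum_nonneg fun i _ => mul_self_nonneg _
  nlinarith

/-- The members floor as the NON-STRICT quadratic-form hypothesis a downstream bound consumes (e.g. the
Gram floors `l²‖v‖₂² ≤ vᵀ(FᵀF)v` of `Literature.Analysis.Matrix.SparseLUSplit.lu_split_solution_bound`):
any `lam ≤ s − c − r` gives `lam·yᵀy ≤ yᵀXy` for ALL `y` and every member `X`.
[cite: Rump2026SparseI, Lemma 2.10 (2.15) with Section 1 (1.2)] [cite: Rump2006, Corollary 2.7] -/
theorem mul_le_quadForm_of_rowCounts_members (hu : 0 ≤ u) (hu1 : u < 1)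
    {A At R : Matrix (Fin n) (Fin n) K} {S : Fin n → Fin n → Finset (Fin n)} (hAt : Atᵀ = At)
    (hrun : SparseCholeskyRun u At R S) (hpos : ∀ j, 0 < R j j)
    {P : Fin n → Finset (Fin n)} (hSP : ∀ i j : Fin n, i ≤ j → S i j ⊆ P i ∩ P j)
    (hPdiag : ∀ i, i ∈ P i) {μ : Fin n → ℕ} (hμ : ∀ i, (P i).card ≤ μ i)
    (hμu : ∀ i, ((μ i + 1 : ℕ) : K) * u < 1)
    {d : Fin n → K} (hd0 : ∀ j, 0 ≤ d j) (hd : ∀ j, (1 + gamma u (μ j + 1)) * At j j ≤ d j ^ 2)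
    {v : Fin n → K} (hv : ∀ i, 0 < v i) {c : K}
    (hc : ∀ i, (errMatrix u (fun i j => min (μ i) (μ j) + 1) d *ᵥ v) i ≤ c * v i)
    {s : K} (hoff : ∀ i j, i ≠ j → At i j = A i j) (hdiag : ∀ i, At i i ≤ A i i - s)
    {Rad : Matrix (Fin n) (Fin n) K} (hRad : Radᵀ = Rad) (hRad0 : ∀ i j, 0 ≤ Rad i j)
    {w : Fin n → K} (hw : ∀ i, 0 < w i) {r : K} (hr : ∀ i, (Rad *ᵥ w) i ≤ r * w i)
    {lam : K} (hlam : lam ≤ s - c - r)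
    (X : Matrix (Fin n) (Fin n) K) (hX : ∀ i j, |X i j - A i j| ≤ Rad i j)
    (y : Fin n → K) : lam * (y ⬝ᵥ y) ≤ y ⬝ᵥ (X *ᵥ y) := by
  have hxx : 0 ≤ y ⬝ᵥ y := sum_nonneg fun i _ => mul_self_nonneg _
  by_cases hy : y = 0
  · rw [hy]; simp
  · have h := hrun.sub_sub_mul_lt_quadForm_of_rowCounts_members hu hu1 hAt hpos hSP hPdiag hμ hμu hd0
      hd hv hc hoff hdiag hRad hRad0 hw hr X hX y hy
    nlinarith [mul_le_mul_of_nonneg_right hlam hxx]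

end SparseCholeskyRun

/-- Over `ℝ`, for a SYMMETRIC member `X` (`|X − A| ≤ Rad`): `s − c − r ≤ λ_i(X)` for every `i` — the
`lam_lo_members` number of the certificate. [cite: Rump2026SparseI, Lemma 2.10 (2.15) with Thm 1.1 (1.4)]
[cite: Rump2006, Corollary 2.7] -/
theorem sub_sub_le_eigenvalues_of_rowCounts_members {u : ℝ} (hu : 0 ≤ u) (hu1 : u < 1) {n : ℕ}
    {A At R : Matrix (Fin n) (Fin n) ℝ} {S : Fin n → Fin n → Finset (Fin n)} (hAt : Atᵀ = At)
    (hrun : SparseCholeskyRun u At R S) (hpos : ∀ j, 0 < R j j)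
    {P : Fin n → Finset (Fin n)} (hSP : ∀ i j : Fin n, i ≤ j → S i j ⊆ P i ∩ P j)
    (hPdiag : ∀ i, i ∈ P i) {μ : Fin n → ℕ} (hμ : ∀ i, (P i).card ≤ μ i)
    (hμu : ∀ i, ((μ i + 1 : ℕ) : ℝ) * u < 1)
    {d : Fin n → ℝ} (hd0 : ∀ j, 0 ≤ d j) (hd : ∀ j, (1 + gamma u (μ j + 1)) * At j j ≤ d j ^ 2)
    {v : Fin n → ℝ} (hv : ∀ i, 0 < v i) {c : ℝ}
    (hc : ∀ i, (errMatrix u (fun i j => min (μ i) (μ j) + 1) d *ᵥ v) i ≤ c * v i)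
    {s : ℝ} (hoff : ∀ i j, i ≠ j → At i j = A i j) (hdiag : ∀ i, At i i ≤ A i i - s)
    {Rad : Matrix (Fin n) (Fin n) ℝ} (hRad : Radᵀ = Rad) (hRad0 : ∀ i j, 0 ≤ Rad i j)
    {w : Fin n → ℝ} (hw : ∀ i, 0 < w i) {r : ℝ} (hr : ∀ i, (Rad *ᵥ w) i ≤ r * w i)
    {X : Matrix (Fin n) (Fin n) ℝ} (hXh : X.IsHermitian) (hX : ∀ i j, |X i j - A i j| ≤ Rad i j)
    (i : Fin n) : s - c - r ≤ hXh.eigenvalues i :=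
  Literature.Analysis.ValidatedNumerics.ParametricEigenMargin.le_eigenvalues_of_forall_form_real hXh
    (SparseCholeskyRun.mul_le_quadForm_of_rowCounts_members (u := u) hu hu1 hAt hrun hpos hSP hPdiag
      hμ hμu hd0 hd hv hc hoff hdiag hRad hRad0 hw hr le_rfl X hX) i

end Members

end Literature.ComputerArithmetic.Rump2026SparseI
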